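import Literature.MathematicalPhysics.QuantumFieldTheory.Balaban1983to89.Beta.HessKerDressedCauchy
import Literature.MathematicalPhysics.QuantumFieldTheory.Balaban1983to89.Beta.SquareTable

/-!
# `BalabanUV.Beta.D1BFx.RoadEnd` — road «BF-x» for binder row D1 (skeleton `HOME/beta/skeletons/D1-b2b-balaban-beta-d1-p2.md`),
# composition leaves C1–C3: THE ROOT BY TYPE (v1 p206903; v1.1 = v1 + §4 APPEND-ONLY, every v1 declaration byte-identical)

HONEST FRAMING (cell contract, verbatim): «discharging `BetaPertH` makes Bałaban's UV stability UNCONDITIONAL — a real constructive-QFT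
result; it is NOT the continuum limit and NOT the Clay problem.»  HONEST DEPENDENCY (verbatim): «continuum YM on T⁴ ⇐ BetaPertH ∧ nine
spine estimates (0/9 proved); BetaPertH ⇐ (D1) ∧ (D4) ∧ CAP+tail; G-an2-4 gates asym, D1 and NE2/3/4.»  THIS MODULE DISCHARGES NOTHING:
it proves that the two gradings of road «BF-x» CLOSE the wall's literal term `OneStepKernelFamily.D1Drift Lc Js N μ ν` BY NAME from their
named binders — every binder is a HYPOTHESIS with free constants; the one-shot coefficient `c : ℕ → ℝ` (the skeleton's `shotCoeff · μ ν`,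
leaf O1) and the scalar leg family `Gf` (the skeleton's `σ`, leaves O2/L1) are FREE PARAMETERS here.  No `def`, no `Prop` mirror, no cited
fact, 0 sorry.

ABSOLUTE RULE (cell, verbatim): «No internally-minted statement may enter as a cited fact. Every hypothesis is either kernel-proved in this
package or a verbatim quotation of a PUBLISHED theorem with page reference. The manuscript(s) under audit are NOT citable for their own
disputed steps — they are the thing under adjudication; programme-internal (2001/route/tribunal) claims are never citable.»

CONTENT (all [folklore] = sequence algebra + the tree's ENDs BY NAME).
* §1 C1 `lim_eq_of_cesaro`: a convergent real sequence whose Cesàro means tend to `s` tends to `s` (Mathlib `Filter.Tendsto.cesaro` +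
  `tendsto_nhds_unique`); `oneLoopDrift_of_allScalesSeq_cesaro`: under an all-scales bound `AllScalesSeq b κ θ`, `0 ≤ θ < 1`, Cesàro
  convergence of `b` to `s` gives `Drift.OneLoopDrift s (κ/(1−θ)) b` (the lead lineage's `HessKerDressedCauchy.oneLoopDrift_lim` at the
  identified limit); `tendsto_cesaro_of_oneLoopDrift` (a drift gives the Cesàro limit outright); `cesaro_of_split`.
* §2 C2 THE MEAN GRADING: `d1Drift_of_cesaro` (any jet data `Js`, an all-scales bound of `j ↦ secondMoment (TbalOf Lc Js j) μ ν` — e.g. from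
  the (CONV-C-Cauchy) binders via `HessKerDressedCauchy.allScalesSeq_secondMoment_TbalOf_dress` — and Cesàro convergence of the step
  coefficients to `stepBal N Lc` ⟹ `D1Drift`), `d1Drift_iff_cesaro` (under an all-scales bound the wall IS the Cesàro statement), and
  `d1Drift_of_meanRoad` (the Cesàro hypothesis split into the road's two pieces: a Cesàro-NULL telescoping defect against a one-shot
  coefficient `c (Lc^m)` (bridge B1_mean) and the MEAN ONE-SHOT LAW `c (Lc^m)/m → stepBal N Lc` (the skeleton's target T_mean)).
* §3 C3 THE STRONG GRADING: `d1Drift_of_strongRoad` — a BOUNDED telescoping defect (bridge B1) + the skeleton's target T in the shape of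
  the `hU` binder of an3's `SquareTable.oneLoopDrift_of_scalarBounds_avg` for a scalar leg family `Gf` + that END's six graded scalar rows
  (leaf L1) ⟹ `D1Drift`, through that END at the trivial instance `μC j m := β⁰_j` (RULING (R16-1)), window cut-off `M n := n`.
* §4 (v1.1, APPEND-ONLY) THE TABLE SIDE DRIFTS BY ITSELF and THE MEAN ROAD END BY TYPE: `tableSide_drift` — under the six graded scalar rows
  alone, the base-point-averaged full-sum table side `F n := Σ_b wt n b · fullSum (stK μ ν N (Gf n b))` obeys `|F (Lc^m) − F 1 − m·stepBal N Lc| ≤ A`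
  (an3's END at the TAUTOLOGICAL split `β⁰_j := F (Lc^(j+1)) − F (Lc^j)`, exactly as the lead's `ScalewiseVectorSeam.oneShotSide_drift`); hence
  `d1Drift_of_meanRoad_table`: all-scales bound + Cesàro-null telescoping defect + the MEAN form of the road's target
  `(c (Lc^m) − F (Lc^m))/m → 0` + the six rows ⟹ `D1Drift` — the mean grading's root with T_mean in the table currency.
NOT summit progress; NOT continuum; NOT Clay.
-/

open Finset Filter Topology
open scoped BigOperators
open Literature.MathematicalPhysics.QuantumFieldTheory.Balaban1983to89
open Literature.MathematicalPhysics.QuantumFieldTheory.Balaban1983to89.Beta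
open RemainderConstAllScales (AllScalesSeq)
open RateCertificate (CauchyRate)
open OneStepResolventKernel (JetData)
open OneStepKernelFamily (TbalOf D1Drift)
open HessKerDressedCauchy (oneLoopDrift_lim)
open MarginalTelescoping (composedCoeff IdentityForm)
open WindowIdentification (fullSum)
open DyadicShell (Pt supNorm)
open SquareTable (stK oneLoopDrift_of_scalarBounds_avg)
open GhostTable (gFree)
open BubbleTransfer (unitVec)
open ScalewiseVectorSeam (splitOf)

namespace Summit.QuantumFields.BalabanUV.Beta.D1BFx.RoadEnd

/-! ## §1 C1 — Cesàro uniqueness and the drift about a Cesàro-identified limit -/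

section Cesaro

/-- [folklore] **C1 (CESÀRO UNIQUENESS).**  If `u → ℓ` and the Cesàro means `(Σ_{j<m} u j)/m → s`, then `ℓ = s`. -/
theorem lim_eq_of_cesaro {u : ℕ → ℝ} {ℓ s : ℝ} (hu : Tendsto u atTop (𝓝 ℓ))
    (hc : Tendsto (fun m : ℕ => (∑ j ∈ range m, u j) / (m : ℝ)) atTop (𝓝 s)) : ℓ = s := by
  have h1 : Tendsto (fun m : ℕ => ((m : ℝ)⁻¹) * ∑ j ∈ range m, u j) atTop (𝓝 ℓ) := hu.cesaro
  have h2 : Tendsto (fun m : ℕ => ((m : ℝ)⁻¹) * ∑ j ∈ range m, u j) atTop (𝓝 s) :=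
    hc.congr' (Eventually.of_forall fun m => by rw [div_eq_inv_mul])
  exact tendsto_nhds_unique h1 h2

/-- [folklore] **THE DRIFT FROM AN ALL-SCALES BOUND AND A CESÀRO LIMIT.**  `AllScalesSeq b κ θ` with `0 ≤ θ < 1` makes `b` converge
(`CauchyRate.tendsto_lim`); if its Cesàro means tend to `s`, the limit is `s` and `HessKerDressedCauchy.oneLoopDrift_lim` gives the drift with
slope `s` and defect `κ/(1−θ)`. -/
theorem oneLoopDrift_of_allScalesSeq_cesaro {b : ℕ → ℝ} {κ θ s : ℝ} (hall : AllScalesSeq b κ θ) (hθ0 : 0 ≤ θ) (hθ1 : θ < 1)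
    (hc : Tendsto (fun m : ℕ => (∑ j ∈ range m, b j) / (m : ℝ)) atTop (𝓝 s)) :
    Drift.OneLoopDrift s (κ / (1 - θ)) b := by
  have hlim : CauchyRate.lim b = s := lim_eq_of_cesaro (hall.cauchyRate.tendsto_lim hθ1) hc
  rw [← hlim]
  exact oneLoopDrift_lim hall hθ0 hθ1

/-- [folklore] A drift `|Σ_{j<m} b j − s·m| ≤ A` gives the Cesàro limit `(Σ_{j<m} b j)/m → s` outright (`|·− s| ≤ A/m`). -/
theorem tendsto_cesaro_of_oneLoopDrift {b : ℕ → ℝ} {s A : ℝ} (h : Drift.OneLoopDrift s A b) :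
    Tendsto (fun m : ℕ => (∑ j ∈ range m, b j) / (m : ℝ)) atTop (𝓝 s) := by
  refine tendsto_sub_nhds_zero_iff.mp ?_
  refine squeeze_zero_norm' ?_ (tendsto_const_div_atTop_nhds_zero_nat A)
  filter_upwards [eventually_ge_atTop 1] with m hm
  have hmpos : (0 : ℝ) < m := by exact_mod_cast hm
  have h1 : (∑ j ∈ range m, b j) / (m : ℝ) - s = ((∑ j ∈ range m, b j) - s * m) / (m : ℝ) := by
    field_simp
  rw [Real.norm_eq_abs, h1, abs_div, abs_of_pos hmpos]
  exact div_le_div_of_nonneg_right (h m) hmpos.le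

/-- [folklore] Splitting a Cesàro hypothesis: if `(Σ_{j<m} b j − c m)/m → 0` and `c m / m → s` then `(Σ_{j<m} b j)/m → s`. -/
theorem cesaro_of_split {b : ℕ → ℝ} {c : ℕ → ℝ} {s : ℝ}
    (hdef : Tendsto (fun m : ℕ => ((∑ j ∈ range m, b j) - c m) / (m : ℝ)) atTop (𝓝 0))
    (hcm : Tendsto (fun m : ℕ => c m / (m : ℝ)) atTop (𝓝 s)) :
    Tendsto (fun m : ℕ => (∑ j ∈ range m, b j) / (m : ℝ)) atTop (𝓝 s) := by
  have h := hdef.add hcm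
  rw [zero_add] at h
  refine h.congr' (Eventually.of_forall fun m => ?_)
  simp only [sub_div, sub_add_cancel]

end Cesaro

/-! ## §2 C2 — the MEAN grading closes the wall -/

section Mean

variable {Lc : ℕ} [NeZero Lc]

/-- [folklore] **C2 (MEAN GRADING, SEQUENCE FORM).**  For ANY jet data `Js`: an all-scales bound of the step coefficients
`β⁰_j := secondMoment (TbalOf Lc Js j) μ ν` with `0 ≤ θ < 1` (however supplied — for the wall's dressed families it is
`HessKerDressedCauchy.allScalesSeq_secondMoment_TbalOf_dress` / `…_TbalOf_JsBalOf` from the six (CONV-C-Cauchy) binders of row G-an2-4)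
and Cesàro convergence `(Σ_{j<m} β⁰_j)/m → stepBal N Lc` give THE WALL'S LITERAL TERM `D1Drift Lc Js N μ ν`, defect `κ/(1−θ)`. -/
theorem d1Drift_of_cesaro (Js : ℕ → JetData 3 Lc) {μ ν : Fin 4} {κ θ : ℝ}
    (hall : AllScalesSeq (fun j => B12Beta.secondMoment (TbalOf Lc Js j) μ ν) κ θ) (hθ0 : 0 ≤ θ) (hθ1 : θ < 1) (N : ℝ)
    (hc : Tendsto (fun m : ℕ => (∑ j ∈ range m, B12Beta.secondMoment (TbalOf Lc Js j) μ ν) / (m : ℝ)) atTop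
      (𝓝 (B12Normalization.stepBal N Lc))) :
    D1Drift Lc Js N μ ν :=
  ⟨κ / (1 - θ), oneLoopDrift_of_allScalesSeq_cesaro hall hθ0 hθ1 hc⟩

/-- [folklore] **C2, IFF FORM** (what the MEAN grading decides): under an all-scales bound with `0 ≤ θ < 1`, `D1Drift Lc Js N μ ν` holds IFF the
Cesàro means of the step coefficients tend to `stepBal N Lc`. -/
theorem d1Drift_iff_cesaro (Js : ℕ → JetData 3 Lc) {μ ν : Fin 4} {κ θ : ℝ}
    (hall : AllScalesSeq (fun j => B12Beta.secondMoment (TbalOf Lc Js j) μ ν) κ θ) (hθ0 : 0 ≤ θ) (hθ1 : θ < 1) (N : ℝ) :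
    D1Drift Lc Js N μ ν ↔
      Tendsto (fun m : ℕ => (∑ j ∈ range m, B12Beta.secondMoment (TbalOf Lc Js j) μ ν) / (m : ℝ)) atTop
        (𝓝 (B12Normalization.stepBal N Lc)) :=
  ⟨fun ⟨_, hA⟩ => tendsto_cesaro_of_oneLoopDrift hA, d1Drift_of_cesaro Js hall hθ0 hθ1 N⟩

/-- [folklore] **C2 (MEAN GRADING, ROAD FORM).**  The Cesàro hypothesis split into road «BF-x»'s two pieces: (B1_mean) a CESÀRO-NULL
telescoping defect of the step coefficients against a one-shot coefficient `c (Lc^m)` (`c` = the skeleton's `shotCoeff · μ ν`; a free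
function here), and (T_mean) the MEAN ONE-SHOT LAW `c (Lc^m)/m → stepBal N Lc`. -/
theorem d1Drift_of_meanRoad (Js : ℕ → JetData 3 Lc) {μ ν : Fin 4} {κ θ : ℝ}
    (hall : AllScalesSeq (fun j => B12Beta.secondMoment (TbalOf Lc Js j) μ ν) κ θ) (hθ0 : 0 ≤ θ) (hθ1 : θ < 1) (N : ℝ)
    (c : ℕ → ℝ)
    (hB1 : Tendsto (fun m : ℕ => ((∑ j ∈ range m, B12Beta.secondMoment (TbalOf Lc Js j) μ ν) - c (Lc ^ m)) / (m : ℝ)) atTop (𝓝 0))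
    (hT : Tendsto (fun m : ℕ => c (Lc ^ m) / (m : ℝ)) atTop (𝓝 (B12Normalization.stepBal N Lc))) :
    D1Drift Lc Js N μ ν :=
  d1Drift_of_cesaro Js hall hθ0 hθ1 N (cesaro_of_split (c := fun m => c (Lc ^ m)) hB1 hT)

end Mean

/-! ## §3 C3 — the STRONG grading closes the wall through an3's base-point-averaged scalar END -/

section Strong

variable {Lc : ℕ} [NeZero Lc] {κB : Type*}

/-- [folklore] **C3 (STRONG GRADING).**  For ANY jet data `Js` and channel `μ ≠ ν`: a BOUNDED telescoping defect of the step coefficients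
`β⁰_j := secondMoment (TbalOf Lc Js j) μ ν` against a one-shot coefficient `c (Lc^m)` (bridge B1: `|Σ_{j<m} β⁰_j − c (Lc^m)| ≤ U₁`), the road's
target T in the shape of the `hU` binder of `SquareTable.oneLoopDrift_of_scalarBounds_avg` (`|c (Lc^m) − Σ_b wt b · fullSum (stK μ ν N (Gf (Lc^m) b))| ≤
U₂`, convex base-point weights), and that END's six graded scalar rows `h0/h1/h2/d0/d1/d2` for the leg family `Gf` (leaf L1; constants `D`, `A`,
`δ` free of the base point) give THE WALL'S LITERAL TERM `D1Drift Lc Js N μ ν` — through an3's END at the trivial instance `μC j m := β⁰_j`,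
`hid := rfl`-grade `IdentityForm`, carrier `ScalewiseVectorSeam.splitOf β⁰`, window cut-off `M n := n`, `cc := 1`. -/
theorem d1Drift_of_strongRoad (Js : ℕ → JetData 3 Lc) {μ ν : Fin 4} (hμν : μ ≠ ν) {N : ℝ} (hN : N ≠ 0) (hL : 2 ≤ Lc)
    (c : ℕ → ℝ) {Bset : ℕ → Finset κB} {wt : ℕ → κB → ℝ} {Gf : ℕ → κB → Pt → ℝ} {D A : ℕ → ℝ}
    (hD : ∀ j, 0 ≤ D j) (hA : ∀ j, 0 ≤ A j) {δ U₁ U₂ : ℝ} (hδ : 0 < δ)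
    (hwt0 : ∀ n : ℕ, 2 ≤ n → ∀ b ∈ Bset n, 0 ≤ wt n b) (hwt1 : ∀ n : ℕ, 2 ≤ n → ∑ b ∈ Bset n, wt n b = 1)
    (h0 : ∀ n : ℕ, 2 ≤ n → ∀ b ∈ Bset n, ∀ v, |Gf n b v - gFree v| ≤ D 0 / (n : ℝ) ^ 2)
    (h1 : ∀ n : ℕ, 2 ≤ n → ∀ b ∈ Bset n, ∀ v (ρ : Fin 4),
      |(Gf n b (v + unitVec ρ) - gFree (v + unitVec ρ)) - (Gf n b v - gFree v)| ≤ D 1 / (n : ℝ) ^ 3)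
    (h2 : ∀ n : ℕ, 2 ≤ n → ∀ b ∈ Bset n, ∀ v,
      |(Gf n b (v + unitVec ν + unitVec μ) - gFree (v + unitVec ν + unitVec μ)) - (Gf n b (v + unitVec ν) - gFree (v + unitVec ν)) -
          (Gf n b (v + unitVec μ) - gFree (v + unitVec μ)) + (Gf n b v - gFree v)| ≤ D 2 / (n : ℝ) ^ 4)
    (d0 : ∀ n : ℕ, 2 ≤ n → ∀ b ∈ Bset n, ∀ v : Pt, v ≠ 0 → |Gf n b v| ≤ A 0 * Real.exp (-(δ / n) * supNorm v) / (supNorm v : ℝ) ^ 2)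
    (d1 : ∀ n : ℕ, 2 ≤ n → ∀ b ∈ Bset n, ∀ v : Pt, v ≠ 0 → ∀ ρ : Fin 4,
      |Gf n b (v + unitVec ρ) - Gf n b v| ≤ A 1 * Real.exp (-(δ / n) * supNorm v) / (supNorm v : ℝ) ^ 3)
    (d2 : ∀ n : ℕ, 2 ≤ n → ∀ b ∈ Bset n, ∀ v : Pt, v ≠ 0 →
      |Gf n b (v + unitVec ν + unitVec μ) - Gf n b (v + unitVec ν) - Gf n b (v + unitVec μ) + Gf n b v| ≤
        A 2 * Real.exp (-(δ / n) * supNorm v) / (supNorm v : ℝ) ^ 4)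
    (hB1 : ∀ m : ℕ, 1 ≤ m → |(∑ j ∈ range m, B12Beta.secondMoment (TbalOf Lc Js j) μ ν) - c (Lc ^ m)| ≤ U₁)
    (hT : ∀ m : ℕ, 1 ≤ m → |c (Lc ^ m) - ∑ b ∈ Bset (Lc ^ m), wt (Lc ^ m) b * fullSum (stK μ ν N (Gf (Lc ^ m) b))| ≤ U₂) :
    D1Drift Lc Js N μ ν := by
  set β0 : ℕ → ℝ := fun j => B12Beta.secondMoment (TbalOf Lc Js j) μ ν with hβ0
  -- the trivial instance μC j m := β⁰_j (RULING (R16-1)): composedCoeff μC m = Σ_{j<m} β⁰_j, IdentityForm by rfl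
  have hid : IdentityForm (fun j _ => β0 j) (splitOf β0).β0 := fun _ _ _ => rfl
  have hcomp : ∀ m, composedCoeff (fun j _ => β0 j) m = ∑ j ∈ range m, β0 j := fun _ => rfl
  have hU : ∀ m : ℕ, 1 ≤ m →
      |composedCoeff (fun j _ => β0 j) m - ∑ b ∈ Bset (Lc ^ m), wt (Lc ^ m) b * fullSum (stK μ ν N (Gf (Lc ^ m) b))| ≤ U₁ + U₂ := by
    intro m hm
    rw [hcomp]
    calc |(∑ j ∈ range m, β0 j) - ∑ b ∈ Bset (Lc ^ m), wt (Lc ^ m) b * fullSum (stK μ ν N (Gf (Lc ^ m) b))|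
        = |((∑ j ∈ range m, β0 j) - c (Lc ^ m)) +
            (c (Lc ^ m) - ∑ b ∈ Bset (Lc ^ m), wt (Lc ^ m) b * fullSum (stK μ ν N (Gf (Lc ^ m) b)))| := by ring_nf
      _ ≤ |(∑ j ∈ range m, β0 j) - c (Lc ^ m)| +
            |c (Lc ^ m) - ∑ b ∈ Bset (Lc ^ m), wt (Lc ^ m) b * fullSum (stK μ ν N (Gf (Lc ^ m) b))| := abs_add_le _ _
      _ ≤ U₁ + U₂ := add_le_add (hB1 m hm) (hT m hm)
  -- window cut-off M n := n, cc := 1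
  have hc : (1 : ℝ) ≤ 1 := le_rfl
  have hM : ∀ L : ℕ, 2 ≤ L → 1 ≤ (fun n : ℕ => n) L ∧ (L : ℝ) ≤ 1 * ((fun n : ℕ => n) L : ℕ) := fun L hL2 =>
    ⟨le_trans (by norm_num) hL2, by simp⟩
  have hML : ∀ L : ℕ, 2 ≤ L → (fun n : ℕ => n) L ≤ L := fun _ _ => le_rfl
  exact ⟨_, oneLoopDrift_of_scalarBounds_avg (splitOf β0) hμν hN hL (μC := fun j _ => β0 j) (M := fun n : ℕ => n) hD hA hδ hwt0
    hwt1 hc hM hML h0 h1 h2 d0 d1 d2 hU hid⟩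

end Strong

/-! ## §4 (v1.1) The table side drifts by itself; the MEAN road end in the table currency -/

section Table

variable {Lc : ℕ} [NeZero Lc] {κB : Type*}

omit [NeZero Lc] in
/-- [folklore] **THE BASE-POINT-AVERAGED TABLE SIDE DRIFTS BY ITSELF.**  Under the six graded scalar rows `h0/h1/h2/d0/d1/d2` of an3's END for a
leg family `Gf` (constants free of the base point) and convex base-point weights, the full-sum table side
`F n := Σ_{b ∈ Bset n} wt n b · fullSum (stK μ ν N (Gf n b))` satisfies `|F (Lc^m) − F (Lc^0) − stepBal N Lc · m| ≤ A` for some `A` and all `m` —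
`SquareTable.oneLoopDrift_of_scalarBounds_avg` at the TAUTOLOGICAL split `β⁰_j := F (Lc^(j+1)) − F (Lc^j)` (for which `hU` holds with
`U := |F (Lc^0)|`), the same device as the lead's `ScalewiseVectorSeam.oneShotSide_drift`.  No one-shot functional is involved. -/
theorem tableSide_drift {μ ν : Fin 4} (hμν : μ ≠ ν) {N : ℝ} (hN : N ≠ 0) (hL : 2 ≤ Lc)
    {Bset : ℕ → Finset κB} {wt : ℕ → κB → ℝ} {Gf : ℕ → κB → Pt → ℝ} {D A : ℕ → ℝ}
    (hD : ∀ j, 0 ≤ D j) (hA : ∀ j, 0 ≤ A j) {δ : ℝ} (hδ : 0 < δ)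
    (hwt0 : ∀ n : ℕ, 2 ≤ n → ∀ b ∈ Bset n, 0 ≤ wt n b) (hwt1 : ∀ n : ℕ, 2 ≤ n → ∑ b ∈ Bset n, wt n b = 1)
    (h0 : ∀ n : ℕ, 2 ≤ n → ∀ b ∈ Bset n, ∀ v, |Gf n b v - gFree v| ≤ D 0 / (n : ℝ) ^ 2)
    (h1 : ∀ n : ℕ, 2 ≤ n → ∀ b ∈ Bset n, ∀ v (ρ : Fin 4),
      |(Gf n b (v + unitVec ρ) - gFree (v + unitVec ρ)) - (Gf n b v - gFree v)| ≤ D 1 / (n : ℝ) ^ 3)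
    (h2 : ∀ n : ℕ, 2 ≤ n → ∀ b ∈ Bset n, ∀ v,
      |(Gf n b (v + unitVec ν + unitVec μ) - gFree (v + unitVec ν + unitVec μ)) - (Gf n b (v + unitVec ν) - gFree (v + unitVec ν)) -
          (Gf n b (v + unitVec μ) - gFree (v + unitVec μ)) + (Gf n b v - gFree v)| ≤ D 2 / (n : ℝ) ^ 4)
    (d0 : ∀ n : ℕ, 2 ≤ n → ∀ b ∈ Bset n, ∀ v : Pt, v ≠ 0 → |Gf n b v| ≤ A 0 * Real.exp (-(δ / n) * supNorm v) / (supNorm v : ℝ) ^ 2)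
    (d1 : ∀ n : ℕ, 2 ≤ n → ∀ b ∈ Bset n, ∀ v : Pt, v ≠ 0 → ∀ ρ : Fin 4,
      |Gf n b (v + unitVec ρ) - Gf n b v| ≤ A 1 * Real.exp (-(δ / n) * supNorm v) / (supNorm v : ℝ) ^ 3)
    (d2 : ∀ n : ℕ, 2 ≤ n → ∀ b ∈ Bset n, ∀ v : Pt, v ≠ 0 →
      |Gf n b (v + unitVec ν + unitVec μ) - Gf n b (v + unitVec ν) - Gf n b (v + unitVec μ) + Gf n b v| ≤
        A 2 * Real.exp (-(δ / n) * supNorm v) / (supNorm v : ℝ) ^ 4) :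
    ∃ A' : ℝ, ∀ m : ℕ,
      |(∑ b ∈ Bset (Lc ^ m), wt (Lc ^ m) b * fullSum (stK μ ν N (Gf (Lc ^ m) b)))
          - (∑ b ∈ Bset (Lc ^ 0), wt (Lc ^ 0) b * fullSum (stK μ ν N (Gf (Lc ^ 0) b)))
          - B12Normalization.stepBal N Lc * m| ≤ A' := by
  set F : ℕ → ℝ := fun n => ∑ b ∈ Bset n, wt n b * fullSum (stK μ ν N (Gf n b)) with hF
  set incr : ℕ → ℝ := fun j => F (Lc ^ (j + 1)) - F (Lc ^ j) with hincr
  have hsum : ∀ m : ℕ, ∑ j ∈ range m, incr j = F (Lc ^ m) - F (Lc ^ 0) := fun m =>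
    Finset.sum_range_sub (fun j => F (Lc ^ j)) m
  have hid : IdentityForm (fun j _ => incr j) (splitOf incr).β0 := fun _ _ _ => rfl
  have hcomp : ∀ m, composedCoeff (fun j _ => incr j) m = ∑ j ∈ range m, incr j := fun _ => rfl
  have hU : ∀ m : ℕ, 1 ≤ m → |composedCoeff (fun j _ => incr j) m - F (Lc ^ m)| ≤ |F (Lc ^ 0)| := by
    intro m _
    rw [hcomp, hsum, show F (Lc ^ m) - F (Lc ^ 0) - F (Lc ^ m) = -F (Lc ^ 0) by ring, abs_neg]
  have hc : (1 : ℝ) ≤ 1 := le_rfl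
  have hM : ∀ L : ℕ, 2 ≤ L → 1 ≤ (fun n : ℕ => n) L ∧ (L : ℝ) ≤ 1 * ((fun n : ℕ => n) L : ℕ) := fun L hL2 =>
    ⟨le_trans (by norm_num) hL2, by simp⟩
  have hML : ∀ L : ℕ, 2 ≤ L → (fun n : ℕ => n) L ≤ L := fun _ _ => le_rfl
  have hdrift := oneLoopDrift_of_scalarBounds_avg (splitOf incr) hμν hN hL (μC := fun j _ => incr j) (M := fun n : ℕ => n) hD hA hδ
    hwt0 hwt1 hc hM hML h0 h1 h2 d0 d1 d2 hU hid
  obtain ⟨A', hA'⟩ : ∃ A' : ℝ, Drift.OneLoopDrift (B12Normalization.stepBal N Lc) A' incr := ⟨_, hdrift⟩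
  refine ⟨A', fun m => ?_⟩
  rw [← hsum]
  exact hA' m

/-- [folklore] **THE MEAN ROAD END IN THE TABLE CURRENCY.**  For ANY jet data `Js`: an all-scales bound of the step coefficients with `0 ≤ θ < 1`
(row G-an2-4's (CONV-C-Cauchy), via `HessKerDressedCauchy`), a CESÀRO-NULL telescoping defect against a one-shot coefficient `c (Lc^m)` (bridge
B1_mean), the MEAN form of road «BF-x»'s target — `(c (Lc^m) − F (Lc^m))/m → 0` with `F` the base-point-averaged full-sum table side over the leg
family `Gf` — and an3's six graded scalar rows for `Gf` ⟹ THE WALL'S LITERAL TERM `D1Drift Lc Js N μ ν`. -/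
theorem d1Drift_of_meanRoad_table (Js : ℕ → JetData 3 Lc) {μ ν : Fin 4} (hμν : μ ≠ ν) {N : ℝ} (hN : N ≠ 0) (hL : 2 ≤ Lc) {κ θ : ℝ}
    (hall : AllScalesSeq (fun j => B12Beta.secondMoment (TbalOf Lc Js j) μ ν) κ θ) (hθ0 : 0 ≤ θ) (hθ1 : θ < 1)
    (c : ℕ → ℝ) {Bset : ℕ → Finset κB} {wt : ℕ → κB → ℝ} {Gf : ℕ → κB → Pt → ℝ} {D A : ℕ → ℝ}
    (hD : ∀ j, 0 ≤ D j) (hA : ∀ j, 0 ≤ A j) {δ : ℝ} (hδ : 0 < δ)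
    (hwt0 : ∀ n : ℕ, 2 ≤ n → ∀ b ∈ Bset n, 0 ≤ wt n b) (hwt1 : ∀ n : ℕ, 2 ≤ n → ∑ b ∈ Bset n, wt n b = 1)
    (h0 : ∀ n : ℕ, 2 ≤ n → ∀ b ∈ Bset n, ∀ v, |Gf n b v - gFree v| ≤ D 0 / (n : ℝ) ^ 2)
    (h1 : ∀ n : ℕ, 2 ≤ n → ∀ b ∈ Bset n, ∀ v (ρ : Fin 4),
      |(Gf n b (v + unitVec ρ) - gFree (v + unitVec ρ)) - (Gf n b v - gFree v)| ≤ D 1 / (n : ℝ) ^ 3)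
    (h2 : ∀ n : ℕ, 2 ≤ n → ∀ b ∈ Bset n, ∀ v,
      |(Gf n b (v + unitVec ν + unitVec μ) - gFree (v + unitVec ν + unitVec μ)) - (Gf n b (v + unitVec ν) - gFree (v + unitVec ν)) -
          (Gf n b (v + unitVec μ) - gFree (v + unitVec μ)) + (Gf n b v - gFree v)| ≤ D 2 / (n : ℝ) ^ 4)
    (d0 : ∀ n : ℕ, 2 ≤ n → ∀ b ∈ Bset n, ∀ v : Pt, v ≠ 0 → |Gf n b v| ≤ A 0 * Real.exp (-(δ / n) * supNorm v) / (supNorm v : ℝ) ^ 2)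
    (d1 : ∀ n : ℕ, 2 ≤ n → ∀ b ∈ Bset n, ∀ v : Pt, v ≠ 0 → ∀ ρ : Fin 4,
      |Gf n b (v + unitVec ρ) - Gf n b v| ≤ A 1 * Real.exp (-(δ / n) * supNorm v) / (supNorm v : ℝ) ^ 3)
    (d2 : ∀ n : ℕ, 2 ≤ n → ∀ b ∈ Bset n, ∀ v : Pt, v ≠ 0 →
      |Gf n b (v + unitVec ν + unitVec μ) - Gf n b (v + unitVec ν) - Gf n b (v + unitVec μ) + Gf n b v| ≤
        A 2 * Real.exp (-(δ / n) * supNorm v) / (supNorm v : ℝ) ^ 4)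
    (hB1 : Tendsto (fun m : ℕ => ((∑ j ∈ range m, B12Beta.secondMoment (TbalOf Lc Js j) μ ν) - c (Lc ^ m)) / (m : ℝ)) atTop (𝓝 0))
    (hT : Tendsto (fun m : ℕ => (c (Lc ^ m) - ∑ b ∈ Bset (Lc ^ m), wt (Lc ^ m) b * fullSum (stK μ ν N (Gf (Lc ^ m) b))) / (m : ℝ))
      atTop (𝓝 0)) :
    D1Drift Lc Js N μ ν := by
  set F : ℕ → ℝ := fun n => ∑ b ∈ Bset n, wt n b * fullSum (stK μ ν N (Gf n b)) with hF
  set s : ℝ := B12Normalization.stepBal N Lc with hs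
  obtain ⟨A', hA'⟩ := tableSide_drift hμν hN hL hD hA hδ hwt0 hwt1 h0 h1 h2 d0 d1 d2
  -- (F (Lc^m) − F 1 − s m)/m → 0 (bounded numerator), F 1 / m → 0, hence F (Lc^m)/m → s, hence c (Lc^m)/m → s
  have hF0 : Tendsto (fun m : ℕ => (F (Lc ^ m) - F (Lc ^ 0) - s * m) / (m : ℝ)) atTop (𝓝 0) := by
    refine squeeze_zero_norm' ?_ (tendsto_const_div_atTop_nhds_zero_nat A')
    filter_upwards [eventually_ge_atTop 1] with m hm
    have hmpos : (0 : ℝ) < m := by exact_mod_cast hm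
    rw [Real.norm_eq_abs, abs_div, abs_of_pos hmpos]
    exact div_le_div_of_nonneg_right (hA' m) hmpos.le
  have hF1 : Tendsto (fun m : ℕ => F (Lc ^ 0) / (m : ℝ)) atTop (𝓝 0) := tendsto_const_div_atTop_nhds_zero_nat _
  have hFm : Tendsto (fun m : ℕ => F (Lc ^ m) / (m : ℝ)) atTop (𝓝 s) := by
    have h := (hF0.add hF1).add (tendsto_const_nhds (x := s))
    rw [zero_add, zero_add] at h
    refine h.congr' ?_
    filter_upwards [eventually_ge_atTop 1] with m hm
    have hmne : (m : ℝ) ≠ 0 := by exact_mod_cast (Nat.one_le_iff_ne_zero.mp hm)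
    field_simp
    ring
  have hcm : Tendsto (fun m : ℕ => c (Lc ^ m) / (m : ℝ)) atTop (𝓝 s) := by
    have h := hT.add hFm
    rw [zero_add] at h
    refine h.congr' (Eventually.of_forall fun m => ?_)
    simp only [hF, sub_div, sub_add_cancel]
  exact d1Drift_of_meanRoad Js hall hθ0 hθ1 N c hB1 hcm

end Table

end Summit.QuantumFields.BalabanUV.Beta.D1BFx.RoadEnd
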